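import Summits.MatrixMultiplication.MatrixMultiplication.Theorems.SoloBlindCorankLeTwo

/-!
# The m-fold deletion formula for the mass `K(τ; B ∪ X)`

Sub-programme (K₃) / Conjecture E, infrastructure for every corank (K3.31): deleting the outside indices `X` one
by one,

  `K(τ; B ∪ X) = ∑_{C ⊆ X} 2^{-|C|} · K_B(τ - ∑_{x ∈ C} h x)`   (`B`, `X` disjoint),

so that for a sum-distinct `B` the mass is the weighted count `∑_C [A_C exists] 2^{-|A_C|-|C|}` of the unique
`B`-representations `A_C` of the shifted targets — the starting point of the corank-`m` analyses
(`SoloBlindCorankTwoKraft`, `SoloBlindConjETwo` did the case `|X| = 2` by hand) and of the all-present product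
formula (K3.31).

* `soloBlind_mass_union_powerset` — the formula above.
* `soloBlind_mass_union_powerset_le` — consequently `K(τ; B ∪ X) ≤ ∑_{C ⊆ X} 2^{-|C|} · K_B(τ - ∑_C h)` term by
  term bounds: if `K_B(τ - ∑_C h) ≤ w C` for all `C ⊆ X` then `K(τ; B ∪ X) ≤ ∑_C 2^{-|C|} w C`.
-/

namespace Summit.MatrixMultiplication.MatrixMultiplication.Theorems

open Finset

universe u

variable {ι : Type*} [DecidableEq ι]
variable {G : Type u} [AddCommGroup G] [DecidableEq G]

/-- THE m-FOLD DELETION FORMULA: for disjoint `B`, `X`,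
`K(τ; B ∪ X) = ∑_{C ⊆ X} (1/2)^{|C|} K_B(τ - ∑_{x ∈ C} h x)`. -/
theorem soloBlind_mass_union_powerset (h : ι → G) {B X : Finset ι} (hd : Disjoint B X) (τ : G) :
    soloBlindMass h (B ∪ X) τ =
      ∑ C ∈ X.powerset, (1 / 2 : ℚ) ^ C.card * soloBlindMass h B (τ - ∑ i ∈ C, h i) := by
  induction X using Finset.induction_on generalizing τ with
  | empty => simp
  | @insert x X hxX ih =>
    have hxB : x ∉ B := fun hx => Finset.disjoint_left.mp hd hx (Finset.mem_insert_self x X)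
    have hd' : Disjoint B X := Finset.disjoint_of_subset_right (Finset.subset_insert x X) hd
    have hxBX : x ∉ B ∪ X := by
      intro hx
      rcases Finset.mem_union.mp hx with hx | hx
      · exact hxB hx
      · exact hxX hx
    rw [Finset.union_insert, soloBlind_mass_erase h (Finset.mem_insert_self x (B ∪ X)) τ,
      Finset.erase_insert hxBX, ih hd' τ, ih hd' (τ - h x), Finset.powerset_insert, Finset.sum_union]
    · congr 1
      rw [Finset.sum_image]
      · rw [Finset.mul_sum]
        refine Finset.sum_congr rfl (fun C hC => ?_)
        have hxC : x ∉ C := fun hx => hxX (Finset.mem_powerset.mp hC hx)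
        rw [Finset.card_insert_of_notMem hxC, Finset.sum_insert hxC, pow_succ]
        have e : τ - h x - ∑ i ∈ C, h i = τ - (h x + ∑ i ∈ C, h i) := by abel
        rw [e]
        ring
      · intro C hC C' hC' e
        have hxC : x ∉ C := fun hx => hxX (Finset.mem_powerset.mp hC hx)
        have hxC' : x ∉ C' := fun hx => hxX (Finset.mem_powerset.mp hC' hx)
        rw [← Finset.erase_insert hxC, e, Finset.erase_insert hxC']
    · rw [Finset.disjoint_left]
      intro C hC hC'
      obtain ⟨C', hC'X, rfl⟩ := Finset.mem_image.mp hC'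
      exact hxX (Finset.mem_powerset.mp hC (Finset.mem_insert_self x C'))

/-- Term-by-term bound from the deletion formula. -/
theorem soloBlind_mass_union_powerset_le (h : ι → G) {B X : Finset ι} (hd : Disjoint B X) (τ : G)
    {w : Finset ι → ℚ} (hw : ∀ C ∈ X.powerset, soloBlindMass h B (τ - ∑ i ∈ C, h i) ≤ w C) :
    soloBlindMass h (B ∪ X) τ ≤ ∑ C ∈ X.powerset, (1 / 2 : ℚ) ^ C.card * w C := by
  rw [soloBlind_mass_union_powerset h hd τ]
  refine Finset.sum_le_sum (fun C hC => ?_)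
  exact mul_le_mul_of_nonneg_left (hw C hC) (by positivity)

/-- In particular, for a sum-distinct `B` (every `K_B ≤ 1`): `K(τ; B ∪ X) ≤ ∑_{C ⊆ X} 2^{-|C|} = (3/2)^{|X|}` — the
trivial bound that (K₃) improves to `1`. -/
theorem soloBlind_mass_union_le_of_sumDistinct (h : ι → G) {B X : Finset ι} (hd : Disjoint B X)
    (hdist : ∀ A ⊆ B, ∀ A' ⊆ B, ∑ i ∈ A, h i = ∑ i ∈ A', h i → A = A') (τ : G) :
    soloBlindMass h (B ∪ X) τ ≤ ∑ C ∈ X.powerset, (1 / 2 : ℚ) ^ C.card := by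
  have e := soloBlind_mass_union_powerset_le h hd τ (w := fun _ => (1 : ℚ))
    (fun C _ => soloBlind_mass_le_one_of_sumDistinct hdist _)
  simpa using e

end Summit.MatrixMultiplication.MatrixMultiplication.Theorems
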